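import Literature.Geometry.Lorentzian.KillingAlgebraAsymptoticallyFlatProofs
import HarnessLib

/-!
# `[V, W] = 0` on an open set ⇒ `W` is invariant under the flow of `V` there (LOCAL form of
# Lee 2012, Thm. 9.42)

`Literature.Geometry.Lorentzian.KillingAlgebraAsymptoticallyFlatProofs` proves Lee's Thm. 9.42 —
"`[V, W] = 0` ⇒ `dθ_t (W p) = W (θ_t p)` for the flow `θ` of `V`" — for fields `W` that are smooth and
commute with `V` on the WHOLE manifold (`eventually_mfderiv_flow_apply_eq_of_ne_zero`,
`mfderiv_flow_apply_eq_of_ne_zero`, `mfderiv_flow_apply_eq`).  Local Killing fields (e.g. the collar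
field of a black hole, or a partially continued Killing field on a sub-level set of a sweep function)
are smooth and `V`-commuting only on an OPEN SET.  This file gives the local statements, by the same
flow-box argument (the proof of the original only ever reads `W` and `[V, W]` along the orbit segment
through `p`):

* `eventually_mfderiv_flow_apply_eq_of_mlieBracket_eq_zero_on` — `W` smooth on an open `O ∋ p` with
  `[V, W] = 0` on `O` and `V p ≠ 0`: `dθ_t (W p) = W (θ_t p)` for all small `t`;
* `mfderiv_flow_apply_eq_of_mlieBracket_eq_zero_on` — if moreover `O` is invariant under the flow and
  `θ` is a `C²` flow with the group law: the identity for ALL `t` (clopen argument along the orbit,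
  which never meets a zero of `V`).

Setting: `C^∞` field `V` on a Hausdorff manifold modelled on a complete normed space `E`
(`𝓘(ℝ, E)`, e.g. `𝓡 4`), as in the original file.  Everything is proved; no definitions, no named
facts.  Used for the crux `NonTrappingHawkingRigidity` of the summit `FinalStateConjecture` (line
`Sketch`: stubs `stub_invariantKillingSubcollar`, `stub_slabPatching` — transport of local Killing
fields by the stationary isometries).

## References

* J. M. Lee, *Introduction to Smooth Manifolds*, 2nd ed., GTM 218, Springer 2012, Thm. 9.22 (flow
  box), Thm. 9.42 (commuting fields and invariance under flows). [LeeSmoothManifolds2013]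
-/

noncomputable section

open Bundle Set Function Filter VectorField
open scoped Manifold ContDiff Topology

namespace Literature.Geometry.Lorentzian

variable {E : Type*} [NormedAddCommGroup E] [NormedSpace ℝ E] [CompleteSpace E]
  {M : Type*} [TopologicalSpace M] [ChartedSpace E M] [IsManifold 𝓘(ℝ, E) ∞ M] [T2Space M]
  {V W : Π x : M, TangentSpace 𝓘(ℝ, E) x} {θ : ℝ × M → M} {O : Set M}

/-- **Local invariance at a regular point, local hypotheses** (Lee 2012, Thm. 9.42, direction
`[V, W] = 0 ⇒ W` invariant under the flow of `V`): `V` a `C^∞` field with flow `θ` (`θ(0, ·) = id`,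
`t ↦ θ(t, p)` integral curves), `W` a section that is `C^∞` on an OPEN set `O` with `[V, W] = 0` on
`O`; then for every `p ∈ O` with `V p ≠ 0` and all small `t`, `dθ_t (W p) = W (θ_t p)`.  Same proof as
`eventually_mfderiv_flow_apply_eq_of_ne_zero` (flow box of `V` about `p`, naturality of the bracket
under the chart, constancy of the chart representative of `W` along the segment), reading `W` and
`[V, W]` only at the points `θ(s, p)`, `|s|` small, which lie in `O`. [cite: LeeSmoothManifolds2013, Thm. 9.42] -/
theorem eventually_mfderiv_flow_apply_eq_of_mlieBracket_eq_zero_on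
    (hV : ContMDiff 𝓘(ℝ, E) 𝓘(ℝ, E).tangent ∞ (fun x ↦ (⟨x, V x⟩ : TangentBundle 𝓘(ℝ, E) M)))
    (hO : IsOpen O)
    (hW : ContMDiffOn 𝓘(ℝ, E) 𝓘(ℝ, E).tangent ∞ (fun x ↦ (⟨x, W x⟩ : TangentBundle 𝓘(ℝ, E) M)) O)
    (hVW : ∀ x ∈ O, mlieBracket 𝓘(ℝ, E) V W x = 0)
    (hθV : ∀ p, IsMIntegralCurve (fun t ↦ θ (t, p)) V) (hθ0 : ∀ p, θ (0, p) = p)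
    {p : M} (hpO : p ∈ O) (hp : V p ≠ 0) :
    ∀ᶠ t in 𝓝 (0 : ℝ),
      mfderiv 𝓘(ℝ, E) 𝓘(ℝ, E) (fun q ↦ θ (t, q)) p (W p) = W (θ (t, p)) := by
  obtain ⟨ψ, hψ, hpψ, hψV, hψv, ε, hε, N, hNo, hpN, hNψ, hbox⟩ :=
    Literature.Geometry.Manifold.exists_flowBox_flow_eq hV hθV hθ0 hp
  set v : E := (show E from V p) with hv_def
  -- `W` is smooth at the points of `O`
  have hWat : ∀ x ∈ O, ContMDiffAt 𝓘(ℝ, E) 𝓘(ℝ, E).tangent ∞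
      (fun x ↦ (⟨x, W x⟩ : TangentBundle 𝓘(ℝ, E) M)) x := fun x hx ↦
    (hW x hx).contMDiffAt (hO.mem_nhds hx)
  -- smoothness of `ψ`, `ψ⁻¹` and the mutual inverse differentials
  have hψt : ∀ q ∈ ψ.target, ContMDiffAt 𝓘(ℝ, E) 𝓘(ℝ, E) ∞ ψ.symm q := fun q hq ↦
    (contMDiffOn_symm_of_mem_maximalAtlas hψ).contMDiffAt (ψ.open_target.mem_nhds hq)
  have hψd : ψ.MDifferentiable 𝓘(ℝ, E) 𝓘(ℝ, E) :=
    ⟨(contMDiffOn_of_mem_maximalAtlas hψ).mdifferentiableOn (by simp),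
      (contMDiffOn_symm_of_mem_maximalAtlas hψ).mdifferentiableOn (by simp)⟩
  have hinv : ∀ x ∈ ψ.source,
      (mfderiv 𝓘(ℝ, E) 𝓘(ℝ, E) ψ.symm (ψ x)).inverse = mfderiv 𝓘(ℝ, E) 𝓘(ℝ, E) ψ x := by
    intro x hx
    refine ContinuousLinearMap.inverse_eq (hψd.symm_comp_deriv hx) ?_
    have h := hψd.comp_symm_deriv (ψ.map_source hx)
    rwa [ψ.left_inv hx] at h
  have hInv : ∀ q ∈ ψ.target, (mfderiv 𝓘(ℝ, E) 𝓘(ℝ, E) ψ.symm q).IsInvertible := by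
    intro q hq
    refine ContinuousLinearMap.IsInvertible.of_inverse
      (g := mfderiv 𝓘(ℝ, E) 𝓘(ℝ, E) ψ (ψ.symm q)) ?_ (hψd.comp_symm_deriv hq)
    have h := hψd.symm_comp_deriv (ψ.map_target hq)
    rwa [ψ.right_inv hq] at h
  -- the chart representatives: `V̂ ≡ v`, `Ŵ = (ψ⁻¹)^* W`
  have hVhat : ∀ q ∈ ψ.target, mpullback 𝓘(ℝ, E) 𝓘(ℝ, E) ψ.symm V q = v := by
    intro q hq
    have hx : ψ.symm q ∈ ψ.source := ψ.map_target hq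
    have h1 := hinv (ψ.symm q) hx
    rw [ψ.right_inv hq] at h1
    rw [mpullback_apply, h1]
    exact hψV (ψ.symm q) hx
  set What : E → E := fun q ↦ mpullback 𝓘(ℝ, E) 𝓘(ℝ, E) ψ.symm W q with hWhat_def
  have hWhat : ∀ x ∈ ψ.source, What (ψ x) = mfderiv 𝓘(ℝ, E) 𝓘(ℝ, E) ψ x (W x) := by
    intro x hx
    simp only [hWhat_def, mpullback_apply]
    rw [hinv x hx, ψ.left_inv hx]
  -- the good points of the target: those whose preimage lies in `O`
  have hWhat_smooth : ∀ q ∈ ψ.target, ψ.symm q ∈ O → ContDiffAt ℝ 1 What q := by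
    intro q hq hqO
    have h := ContMDiffAt.mpullback_vectorField_preimage (I := 𝓘(ℝ, E)) (I' := 𝓘(ℝ, E))
      (m := 1) (n := ∞) ((hWat _ hqO).of_le (by exact_mod_cast le_top)) (hψt q hq) (hInv q hq)
      (WithTop.coe_le_coe.2 le_top)
    exact contMDiffAt_vectorSpace_iff_contDiffAt.1 h
  -- `[V, W] = 0` read in the box: `DŴ · v = 0` at the good points of the target
  haveI : IsManifold 𝓘(ℝ, E) (minSmoothness ℝ 2) M := by
    rw [minSmoothness_of_isRCLikeNormedField]
    infer_instance
  have hbr : ∀ q ∈ ψ.target, ψ.symm q ∈ O → fderiv ℝ What q v = 0 := by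
    intro q hq hqO
    have key := mpullback_mlieBracket (I := 𝓘(ℝ, E)) (I' := 𝓘(ℝ, E)) (f := ψ.symm) (V := V)
      (W := W) (x₀ := q) ((hV _).mdifferentiableAt (by simp))
      ((hWat _ hqO).mdifferentiableAt (by simp))
      (hψt q hq) (by
        rw [minSmoothness_of_isRCLikeNormedField]
        exact (ENat.LEInfty.out : (2 : ℕ∞ω) ≤ ∞))
    rw [mpullback_apply, hVW _ hqO, map_zero, ← mlieBracketWithin_univ,
      mlieBracketWithin_eq_lieBracketWithin, lieBracketWithin_univ] at key
    have hV' : (fun q ↦ mpullback 𝓘(ℝ, E) 𝓘(ℝ, E) ψ.symm V q) =ᶠ[𝓝 q] fun _ ↦ v := by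
      filter_upwards [ψ.open_target.mem_nhds hq] with q' hq' using hVhat q' hq'
    rw [hV'.lieBracket_vectorField_eq EventuallyEq.rfl] at key
    simp only [lieBracket, fderiv_fun_const, Pi.zero_apply, zero_apply, sub_zero] at key
    exact key.symm
  -- a smaller `ε'` so that the orbit segment stays in `O`
  have hcont : Continuous fun s : ℝ ↦ θ (s, p) := (hθV p).continuous
  obtain ⟨ε', hε', hε'O⟩ : ∃ ε' > (0 : ℝ), ∀ s ∈ Ioo (-ε') ε', θ (s, p) ∈ O := by
    have hmem : (fun s : ℝ ↦ θ (s, p)) ⁻¹' O ∈ 𝓝 (0 : ℝ) := by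
      apply hcont.continuousAt.preimage_mem_nhds
      rw [hθ0]; exact hO.mem_nhds hpO
    obtain ⟨δ, hδ, hball⟩ := Metric.mem_nhds_iff.mp hmem
    refine ⟨δ, hδ, fun s hs ↦ hball ?_⟩
    rw [Metric.mem_ball, Real.dist_eq, sub_zero, abs_lt]
    exact hs
  set ε₀ : ℝ := min ε ε' with hε₀
  have hε₀pos : 0 < ε₀ := lt_min hε hε'
  have hsub : Ioo (-ε₀) ε₀ ⊆ Ioo (-ε) ε := fun s hs ↦
    ⟨lt_of_le_of_lt (neg_le_neg (min_le_left _ _)) hs.1, lt_of_lt_of_le hs.2 (min_le_left _ _)⟩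
  have hsub' : Ioo (-ε₀) ε₀ ⊆ Ioo (-ε') ε' := fun s hs ↦
    ⟨lt_of_le_of_lt (neg_le_neg (min_le_right _ _)) hs.1, lt_of_lt_of_le hs.2 (min_le_right _ _)⟩
  -- translation invariance of `Ŵ` along the segment `ψ p + s v`, `|s| < ε₀`
  have hseg : ∀ s ∈ Ioo (-ε₀) ε₀, ψ p + s • v ∈ ψ.target := fun s hs ↦ (hbox p hpN s (hsub hs)).1
  have hsegO : ∀ s ∈ Ioo (-ε₀) ε₀, ψ.symm (ψ p + s • v) ∈ O := by
    intro s hs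
    rw [← (hbox p hpN s (hsub hs)).2.2.1]
    exact hε'O s (hsub' hs)
  have hderiv : ∀ s ∈ Ioo (-ε₀) ε₀, HasDerivAt (fun s : ℝ ↦ What (ψ p + s • v)) (0 : E) s := by
    intro s hs
    have h1 : HasDerivAt (fun s : ℝ ↦ ψ p + s • v) v s := by
      simpa using ((hasDerivAt_id s).smul_const v).const_add (ψ p)
    have h2 : HasFDerivAt What (fderiv ℝ What (ψ p + s • v)) (ψ p + s • v) :=
      ((hWhat_smooth _ (hseg s hs) (hsegO s hs)).differentiableAt one_ne_zero).hasFDerivAt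
    have h3 := h2.comp_hasDerivAt s h1
    rwa [hbr _ (hseg s hs) (hsegO s hs)] at h3
  have hconst : ∀ s ∈ Ioo (-ε₀) ε₀, What (ψ p + s • v) = What (ψ p) := by
    intro s hs
    have h0 : (0 : ℝ) ∈ Ioo (-ε₀) ε₀ := ⟨by linarith, hε₀pos⟩
    have key := (convex_Ioo (-ε₀) ε₀).is_const_of_fderivWithin_eq_zero (𝕜 := ℝ)
      (f := fun s : ℝ ↦ What (ψ p + s • v))
      (fun s hs ↦ (hderiv s hs).differentiableAt.differentiableWithinAt)
      (fun s hs ↦ by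
        rw [fderivWithin_of_isOpen isOpen_Ioo hs, (hderiv s hs).hasFDerivAt.fderiv]
        ext
        simp) hs h0
    simpa using key
  -- conclusion, for `|t| < ε₀`
  filter_upwards [Ioo_mem_nhds (neg_lt_zero.2 hε₀pos) hε₀pos] with t ht
  obtain ⟨hq, -, hθeq, -⟩ := hbox p hpN t (hsub ht)
  have hev : (fun q ↦ θ (t, q)) =ᶠ[𝓝 p] fun q ↦ ψ.symm (ψ q + t • v) := by
    filter_upwards [hNo.mem_nhds hpN] with x hx using (hbox x hx t (hsub ht)).2.2.1
  rw [hev.mfderiv_eq]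
  have h1 : HasMFDerivAt 𝓘(ℝ, E) 𝓘(ℝ, E) ψ p (mfderiv 𝓘(ℝ, E) 𝓘(ℝ, E) ψ p) :=
    (hψd.mdifferentiableAt hpψ).hasMFDerivAt
  have h2 : HasMFDerivAt 𝓘(ℝ, E) 𝓘(ℝ, E) (fun q : E ↦ q + t • v) (ψ p)
      (ContinuousLinearMap.id ℝ (TangentSpace 𝓘(ℝ, E) (ψ p))) :=
    hasMFDerivAt_iff_hasFDerivAt.2 ((hasFDerivAt_id _).add_const _)
  have h3 : HasMFDerivAt 𝓘(ℝ, E) 𝓘(ℝ, E) ψ.symm (ψ p + t • v)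
      (mfderiv 𝓘(ℝ, E) 𝓘(ℝ, E) ψ.symm (ψ p + t • v)) :=
    (hψd.mdifferentiableAt_symm hq).hasMFDerivAt
  have hcomp : HasMFDerivAt 𝓘(ℝ, E) 𝓘(ℝ, E) (fun q ↦ ψ.symm (ψ q + t • v)) p
      ((mfderiv 𝓘(ℝ, E) 𝓘(ℝ, E) ψ.symm (ψ p + t • v)).comp
        ((ContinuousLinearMap.id ℝ (TangentSpace 𝓘(ℝ, E) (ψ p))).comp
          (mfderiv 𝓘(ℝ, E) 𝓘(ℝ, E) ψ p))) :=
    h3.comp p (h2.comp p h1)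
  rw [hcomp.mfderiv]
  change mfderiv 𝓘(ℝ, E) 𝓘(ℝ, E) ψ.symm (ψ p + t • v) (mfderiv 𝓘(ℝ, E) 𝓘(ℝ, E) ψ p (W p)) =
    W (θ (t, p))
  rw [← hWhat p hpψ, ← hconst t ht, hθeq]
  simp only [hWhat_def, mpullback_apply]
  have h := ContinuousLinearMap.ext_iff.1 (hInv _ hq).self_comp_inverse
    (W (ψ.symm (ψ p + t • v)))
  simpa using h

/-- **`[V, W] = 0` on a flow-invariant open set implies invariance of `W` under the flow there, for
all times** (local form of Lee 2012, Thm. 9.42): under the hypotheses of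
`eventually_mfderiv_flow_apply_eq_of_mlieBracket_eq_zero_on`, for a `C²` flow `θ` with the group law
and an open set `O` INVARIANT under the flow (`θ(t, x) ∈ O` for `x ∈ O`), at every `p ∈ O` with
`V p ≠ 0`: `dθ_t (W p) = W (θ_t p)` for all `t`.  The set of good times is closed (equaliser of two
continuous curves in the Hausdorff `TM`; `W` is continuous at the orbit points, which lie in `O`) and
open (near a good time `t₀`, `θ_t = θ_{t−t₀} ∘ θ_{t₀}` and the local statement applies at
`θ_{t₀} p ∈ O`, where `V ≠ 0` since a vector field has no zero on a non-trivial orbit).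
[cite: LeeSmoothManifolds2013, Thm. 9.42] -/
theorem mfderiv_flow_apply_eq_of_mlieBracket_eq_zero_on
    (hV : ContMDiff 𝓘(ℝ, E) 𝓘(ℝ, E).tangent ∞ (fun x ↦ (⟨x, V x⟩ : TangentBundle 𝓘(ℝ, E) M)))
    (hO : IsOpen O) (hOθ : ∀ (t : ℝ) (x : M), x ∈ O → θ (t, x) ∈ O)
    (hW : ContMDiffOn 𝓘(ℝ, E) 𝓘(ℝ, E).tangent ∞ (fun x ↦ (⟨x, W x⟩ : TangentBundle 𝓘(ℝ, E) M)) O)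
    (hVW : ∀ x ∈ O, mlieBracket 𝓘(ℝ, E) V W x = 0)
    (hθ : ContMDiff (𝓘(ℝ, ℝ).prod 𝓘(ℝ, E)) 𝓘(ℝ, E) 2 θ)
    (hθV : ∀ p, IsMIntegralCurve (fun t ↦ θ (t, p)) V) (hθ0 : ∀ p, θ (0, p) = p)
    (hθadd : ∀ t s p, θ (t, θ (s, p)) = θ (t + s, p)) {p : M} (hpO : p ∈ O) (hp : V p ≠ 0) (t : ℝ) :
    mfderiv 𝓘(ℝ, E) 𝓘(ℝ, E) (fun q ↦ θ (t, q)) p (W p) = W (θ (t, p)) := by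
  have hV1 : ContMDiff 𝓘(ℝ, E) 𝓘(ℝ, E).tangent 1
      (fun x ↦ (⟨x, V x⟩ : TangentBundle 𝓘(ℝ, E) M)) := hV.of_le (by exact_mod_cast le_top)
  set S : Set ℝ :=
    {t | mfderiv 𝓘(ℝ, E) 𝓘(ℝ, E) (fun q ↦ θ (t, q)) p (W p) = W (θ (t, p))} with hS
  suffices h : S = univ by
    have ht : t ∈ S := h ▸ mem_univ t
    exact ht
  haveI : T2Space (TangentBundle 𝓘(ℝ, E) M) := t2Space_totalSpace
  refine IsClopen.eq_univ ⟨?_, ?_⟩ ⟨0, ?_⟩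
  · -- closed: equaliser of two continuous curves in `TM`
    have hF : Continuous fun t : ℝ ↦
        (TotalSpace.mk' E (θ (t, p)) (mfderiv 𝓘(ℝ, E) 𝓘(ℝ, E) (fun q ↦ θ (t, q)) p (W p)) :
          TangentBundle 𝓘(ℝ, E) M) :=
      PseudoRiemannianMetric.continuous_lift_mfderiv_flow hθ p (W p)
    have horb : Continuous fun t : ℝ ↦ θ (t, p) :=
      hθ.continuous.comp (continuous_id.prodMk continuous_const)
    have hG : Continuous fun t : ℝ ↦
        (TotalSpace.mk' E (θ (t, p)) (W (θ (t, p))) : TangentBundle 𝓘(ℝ, E) M) := by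
      have hWc : ContinuousOn (fun x ↦ (⟨x, W x⟩ : TangentBundle 𝓘(ℝ, E) M)) O := hW.continuousOn
      exact hWc.comp_continuous horb fun s ↦ hOθ s p hpO
    have hcl := isClosed_eq hF hG
    convert hcl using 1
    ext t
    simp only [hS, mem_setOf_eq, TotalSpace.mk_inj]
  · -- open: propagate from a good time `t₀` by the local statement at `θ (t₀, p) ∈ O`
    rw [isOpen_iff_mem_nhds]
    intro t₀ ht₀
    have hz : V (θ (t₀, p)) ≠ 0 := by
      -- a vector field has no zero on a non-trivial orbit
      intro hz
      have hconst : ∀ s, θ (s, θ (t₀, p)) = θ (t₀, p) := fun s ↦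
        (eq_flow_of_isMIntegralCurve hV1 hθV hθ0 (isMIntegralCurve_const hz) s).symm
      have hp0 : θ (t₀, p) = p := by
        have h := hconst (-t₀)
        rw [hθadd, neg_add_cancel, hθ0] at h
        exact h.symm
      exact hp (hp0 ▸ hz)
    have hA := eventually_mfderiv_flow_apply_eq_of_mlieBracket_eq_zero_on hV hO hW hVW hθV hθ0
      (hOθ t₀ p hpO) hz
    have hT : Tendsto (fun t : ℝ ↦ t - t₀) (𝓝 t₀) (𝓝 0) := by
      have h : Tendsto (fun t : ℝ ↦ t - t₀) (𝓝 t₀) (𝓝 (t₀ - t₀)) :=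
        tendsto_id.sub tendsto_const_nhds
      rwa [sub_self] at h
    filter_upwards [hT.eventually hA] with t ht
    have ht₀' : mfderiv 𝓘(ℝ, E) 𝓘(ℝ, E) (fun q ↦ θ (t₀, q)) p (W p) = W (θ (t₀, p)) := ht₀
    show mfderiv 𝓘(ℝ, E) 𝓘(ℝ, E) (fun q ↦ θ (t, q)) p (W p) = W (θ (t, p))
    have hfun : (fun q ↦ θ (t, q)) = (fun q ↦ θ (t - t₀, q)) ∘ (fun q ↦ θ (t₀, q)) := by
      funext q
      simp [hθadd]
    have hd1 := PseudoRiemannianMetric.mdifferentiableAt_flow hθ (t - t₀) (θ (t₀, p))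
    have hd2 := PseudoRiemannianMetric.mdifferentiableAt_flow hθ t₀ p
    rw [hfun, mfderiv_comp p hd1 hd2]
    change mfderiv 𝓘(ℝ, E) 𝓘(ℝ, E) (fun q ↦ θ (t - t₀, q)) (θ (t₀, p))
      (mfderiv 𝓘(ℝ, E) 𝓘(ℝ, E) (fun q ↦ θ (t₀, q)) p (W p)) = W (θ (t, p))
    rw [ht₀', ht, hθadd, sub_add_cancel]
  · -- `0 ∈ S`: `θ_0 = id`
    show mfderiv 𝓘(ℝ, E) 𝓘(ℝ, E) (fun q ↦ θ (0, q)) p (W p) = W (θ (0, p))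
    have hid : (fun q ↦ θ (0, q)) = id := funext hθ0
    rw [hid, mfderiv_id]
    change W p = W (θ (0, p))
    rw [hθ0]

end Literature.Geometry.Lorentzian

end
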